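import Summits.HodgeConjecture.HodgeConjecture.Theorems.Ring2AbelianAllLandherr
import Summits.HodgeConjecture.HodgeConjecture.Theorems.Ring2HypothesesWeilDiscriminantHolds
import Summits.HodgeConjecture.HodgeConjecture.Theorems.Ring2HypothesesWeilPowers
import HarnessLib

/-!
# Ring 2 — hypotheses layer, part XXX-C: the LANDHERR BINDER LEDGER of the hypotheses axis after node 47 landed — the residual `(hL)` / `(hL')` rows of parts VII-B / XIII / XXIX binder-free, and the row-by-row account

HONEST FRAMING: research route conditional on HC_CM; not a corollary; Q11.4-sentence-2 already refuted in dim ≥ 3.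

Cell `pub-hodge-ring2`, seat `pub-hodge-ring2-typer2`, gen 21 (LEAD's ONE owner re-base round for the Landherr binder,
typer2's share). Bookkeeping only; no new hypothesis node, no new class target.

WHAT HAPPENED. The obligation nodes `LandherrSplitCriterion` (VII-B, node 37: van Geemen 5.4 / (5.4.1) after
Landherr 1936, `H` hyperbolic ⟺ `det H = (-1)ⁿ`) and its converse half `LandherrHyperbolicOfSplitDiscriminant`
(XXVIII, node 47) are THEOREMS of the tree: `Ring2.AbelianAll.landherrHyperbolicOfSplitDiscriminant_holds` and
`Ring2.AbelianAll.landherrSplitCriterion_holds` (seat ab-weil-2, `Theorems/Ring2AbelianAllLandherr.lean`, over the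
Literature carrier theorem `VanGeemen1994.isHyperbolicWeilType_of_hasWeilDiscriminantNondeg_split`, itself over
`Motives.exists_lagrangian_of_weilDiscriminant_eq` — Landherr's Hasse principle for the `K`-Hermitian form, `K`
imaginary quadratic). COUNT ONCE: those two theorems and the seven binder-free rows already landed there
(`splitWeilAbelianVarieties_iff_split_components'`, `hyperbolicSixfolds_iff_split_components'`,
`weilClassesComponent_split_two_of_markman2023'`, `…_split_three_of_markmanSixfolds'`, `…_split_three_three_of_schoen'`,
`…_split_three_one_of_koike'`, `nonsplitSixfolds_of_negative_nonsplit_components'`) are ab-weil-2's and are only USED here.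

WHAT THIS FILE ADDS (the rows of typer2's files that still displayed a Landherr binder and have no binder-free form
elsewhere), all over `landherrHyperbolicOfSplitDiscriminant_holds` / `landherrSplitCriterion_holds` by one term:

| Row | Name | Re-bases | Remaining hypotheses |
|---|---|---|---|
| L1 | `weilClassesComponent_split_of_splitWeilAbelianVarieties'` | VII-B W4 (→) l.161 / XXVIII S6 | none (R2 ⟹ each split cell `(n, d, (-1)ⁿ)`, `n ≥ 4`) |
| L2 | `nonsplitSixfolds_of_nonsplit_components'` | VII-B W4 (R1′) l.193 / XXVIII S6 / XXIX §6 | none (ALL non-split sixfold cells `δ ≠ -1` ⟹ R1′; ab-weil-1's sign-halved variant is `Ring2.AbelianAll.nonsplitSixfolds_of_negative_nonsplit_components'`) |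
| L3 | `hodgePowersOfGeneralWeilTypeComponent_split_three_three_of_schoen'` | XIII PW5 l.246 | `VanGeemen1994_thm612`, `UsualHodgePowersOfGeneralWeilType`, Schoen's fact — by name |
| L4 | `hodgePowersOfGeneralWeilTypeComponent_split_three_one_of_koike'` | XIII PW5 l.257 | the same with Koike's fact |
| L5 | `hodgePowersOfGeneralWeilTypeComponent_split_three_of_markmanSixfolds'` | XIII PW5 l.266 | the same with the UNREFEREED floor fact F2 |
| L6 | `landherr_binder_ledger` | — | audit conjunction: node 37, node 47, W4 exactness, F2 exactness, hold with NO hypothesis |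

LANDHERR BINDER LEDGER (every row of the hypotheses axis that displayed `(hL : LandherrSplitCriterion)` or
`(hL' : LandherrHyperbolicOfSplitDiscriminant)` ↦ its binder-free form; 21 rows, 0 left):
VII-B `weilClassesComponent_split_of_splitWeilAbelianVarieties` ↦ L1; `splitWeilAbelianVarieties_of_split_components`
↦ XXVIII `splitWeilAbelianVarieties_of_split_components_holds` (S2, gen 19, never needed Landherr);
`splitWeilAbelianVarieties_iff_split_components` ↦ `Ring2.AbelianAll.splitWeilAbelianVarieties_iff_split_components'`;
`nonsplitSixfolds_of_nonsplit_components` ↦ L2; `weilClassesComponent_split_two_of_markman2023` /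
`…_split_three_of_markmanSixfolds` / `…_split_three_three_of_schoen` / `…_split_three_one_of_koike` ↦ the primed rows of
`Ring2AbelianAllLandherr`; XXVIII node `LandherrHyperbolicOfSplitDiscriminant` ↦ `…landherrHyperbolicOfSplitDiscriminant_holds`,
`landherrSplitCriterion_of_hyperbolicOfSplitDiscriminant` ↦ `…landherrSplitCriterion_holds`,
`landherrHyperbolicOfSplitDiscriminant_of_landherrSplitCriterion` / `…_iff_…` ↦ both sides theorems; the eight `_of_converse`
rows of XXVIII §6 ↦ as their VII-B originals above (`hyperbolicSixfolds_iff_split_components_of_converse` ↦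
`Ring2.AbelianAll.hyperbolicSixfolds_iff_split_components'`); XXIX `nonsplitSixfolds_of_nonsplit_components_holds` /
`…_of_converse_holds` ↦ L2; XIII PW5 ×3 ↦ L3–L5. The Landherr nodes 37 / 47 leave the OPEN column of the
hypotheses-axis census (DISCHARGED, by ab-weil-2); the hypotheses that remain on these rows are the honest ones:
`HC_CM` where displayed, van Geemen 6.12 and Abdulali Thm. 4.1 as named facts, the cell facts by name (Schoen, Koike
refereed; Markman 2025 unrefereed), and the open class targets themselves.

[cite: vanGeemen1994HodgeAV, Lemma 5.2, 5.4 and (5.4.1) (PDF p. 220)] [cite: Landherr1936HermitianForms]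
[cite: Deligne1982HodgeCycles, §4 Cor. 4.2] [cite: Markman2025SurveySecant, §1.1, §11.5 Step 1 and §12]
-/

noncomputable section

set_option linter.dupNamespace false

open CategoryTheory
open Literature.AlgebraicGeometry Literature.AlgebraicGeometry.Motives Literature.AlgebraicGeometry.VanGeemen1994
open Literature.AlgebraicGeometry.HodgeTheory
open Summit.HodgeConjecture.HodgeConjecture.WeilTypeLadder
open Summit.HodgeConjecture.HodgeConjecture.Ring2.AbelianAll (landherrHyperbolicOfSplitDiscriminant_holds
  landherrSplitCriterion_holds)

namespace Summit.HodgeConjecture.HodgeConjecture.Ring2.Hypotheses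

/-! ### §1 The residual rows, binder-free -/

/-- **L1 — W4 (→), no binder: rung R2 `SplitWeilAbelianVarieties` gives every split cell `(n, d, (-1)ⁿ)`, `n ≥ 4`,
`d ≥ 1`.** (VII-B `weilClassesComponent_split_of_splitWeilAbelianVarieties` over node 37, now a theorem.)
[cite: vanGeemen1994HodgeAV, 5.4 and (5.4.1)] [cite: Markman2025SurveySecant, §12] -/
theorem weilClassesComponent_split_of_splitWeilAbelianVarieties' (h : SplitWeilAbelianVarieties) {n d : ℕ}
    (hn : 4 ≤ n) (hd : 0 < d) : WeilClassesComponent n d (splitDiscriminantClass n d) :=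
  weilClassesComponent_split_of_splitWeilAbelianVarieties landherrSplitCriterion_holds h hn hd

/-- **L2 — R1′, no binder: `NonsplitSixfolds` from ALL the NON-split sixfold cells `(3, d, δ)`, `δ ≠ [-1]`.**
(VII-B W4 / XXIX §6 over node 47, now a theorem, and the typed Lemma 5.2 `polarizedWeilDiscriminantExists_holds`.)
Only this direction: a fixed `(A, φ)` carries polarizations of several discriminants.
[cite: vanGeemen1994HodgeAV, Lemma 5.2 and (5.4.1)] [cite: Markman2025SurveySecant, §1.1 and §11.5 Step 1] -/
theorem nonsplitSixfolds_of_nonsplit_components'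
    (h : ∀ (d : ℕ), 0 < d → ∀ δ : weilNormResidueGroup d, δ ≠ splitDiscriminantClass 3 d →
      WeilClassesComponent 3 d δ) : NonsplitSixfolds :=
  nonsplitSixfolds_of_nonsplit_components_of_converse_holds landherrHyperbolicOfSplitDiscriminant_holds h

/-- **L3 — PW5, `K = ℚ(√-3)`, no Landherr binder: every power of the GENERAL split abelian sixfold of Weil type over
`ℚ(√-3)`** — Schoen's refereed fact, van Geemen 6.12 and Abdulali Thm. 4.1 BY NAME.
[cite: Abdulali2016TateTwists, App. A 1(b)(ii) and Thm. 4.1] [cite: Schoen1998HodgeWeilAddendum]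
[cite: vanGeemen1994HodgeAV, 7.3, (5.4.1) and Thm. 6.12] -/
theorem hodgePowersOfGeneralWeilTypeComponent_split_three_three_of_schoen' (h612 : VanGeemen1994_thm612)
    (hAbd : UsualHodgePowersOfGeneralWeilType) (hS : Schoen1998_weilClasses_algebraic_hyperbolicSixfold_three) :
    HodgePowersOfGeneralWeilTypeComponent 3 3 (splitDiscriminantClass 3 3) :=
  hodgePowersOfGeneralWeilTypeComponent_split_three_three_of_schoen h612 hAbd landherrSplitCriterion_holds hS

/-- **L4 — PW5, `K = ℚ(i)`, no Landherr binder** — Koike 2004, 6.12, Abdulali Thm. 4.1 BY NAME.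
[cite: Abdulali2016TateTwists, App. A 1(b)(ii) and Thm. 4.1] [cite: Koike2004WeilHodge, Thm. 2.1 and Cor. 2.1]
[cite: vanGeemen1994HodgeAV, (5.4.1) and Thm. 6.12] -/
theorem hodgePowersOfGeneralWeilTypeComponent_split_three_one_of_koike' (h612 : VanGeemen1994_thm612)
    (hAbd : UsualHodgePowersOfGeneralWeilType) (hK : Koike2004_weilClasses_algebraic_hyperbolicSixfold_one) :
    HodgePowersOfGeneralWeilTypeComponent 3 1 (splitDiscriminantClass 3 1) :=
  hodgePowersOfGeneralWeilTypeComponent_split_three_one_of_koike h612 hAbd landherrSplitCriterion_holds hK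

/-- **L5 — PW5, every `d`, no Landherr binder, from the UNREFEREED floor fact F2** (Markman 2025 Thm. 1.5.1 BY NAME).
[cite: Markman2025SecantWeil, Thm. 1.5.1 (preprint, unrefereed)] [cite: Abdulali2016TateTwists, Thm. 4.1]
[cite: vanGeemen1994HodgeAV, (5.4.1) and Thm. 6.12] -/
theorem hodgePowersOfGeneralWeilTypeComponent_split_three_of_markmanSixfolds' (h612 : VanGeemen1994_thm612)
    (hAbd : UsualHodgePowersOfGeneralWeilType) (hM : Markman2025_weilClasses_algebraic_hyperbolicSixfold) {d : ℕ}
    (hd : 0 < d) : HodgePowersOfGeneralWeilTypeComponent 3 d (splitDiscriminantClass 3 d) :=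
  hodgePowersOfGeneralWeilTypeComponent_split_three_of_markmanSixfolds h612 hAbd landherrSplitCriterion_holds hM hd

/-! ### §2 Audit -/

/-- **L6 — LANDHERR BINDER LEDGER, audit**: both Landherr nodes, the W4 exactness `R2 ↔ all split cells (n ≥ 4)`, the
F2 exactness `F2 ↔ all split sixfold cells`, and R1′ ⟸ the non-split sixfold cells hold with NO hypothesis.
[cite: vanGeemen1994HodgeAV, 5.4 and (5.4.1)] [cite: Landherr1936HermitianForms] -/
theorem landherr_binder_ledger :
    LandherrSplitCriterion ∧ LandherrHyperbolicOfSplitDiscriminant ∧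
      (SplitWeilAbelianVarieties ↔
        ∀ (n : ℕ), 4 ≤ n → ∀ (d : ℕ), 0 < d → WeilClassesComponent n d (splitDiscriminantClass n d)) ∧
      (Markman2025_weilClasses_algebraic_hyperbolicSixfold ↔
        ∀ (d : ℕ), 0 < d → WeilClassesComponent 3 d (splitDiscriminantClass 3 d)) ∧
      ((∀ (d : ℕ), 0 < d → ∀ δ : weilNormResidueGroup d, δ ≠ splitDiscriminantClass 3 d →
          WeilClassesComponent 3 d δ) → NonsplitSixfolds) :=
  ⟨landherrSplitCriterion_holds, landherrHyperbolicOfSplitDiscriminant_holds,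
    splitWeilAbelianVarieties_iff_split_components_of_converse landherrHyperbolicOfSplitDiscriminant_holds,
    hyperbolicSixfolds_iff_split_components_of_converse landherrHyperbolicOfSplitDiscriminant_holds,
    nonsplitSixfolds_of_nonsplit_components'⟩

/-- On-path (audit): under the Hodge conjecture the data of L1–L2 hold outright, so the re-based rows lie on the
path to the summit (VII-B `weilClassesComponent_of_hodgeConjecture`). [cite: Deligne2000, §1] -/
theorem landherrRebase_rows_of_hodgeConjecture (h : _root_.HodgeConjecture) :
    (∀ (n d : ℕ), 4 ≤ n → 0 < d → WeilClassesComponent n d (splitDiscriminantClass n d)) ∧ NonsplitSixfolds :=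
  ⟨fun n d _ _ ↦ weilClassesComponent_of_hodgeConjecture h n d _,
    nonsplitSixfolds_of_nonsplit_components' fun d _ δ _ ↦ weilClassesComponent_of_hodgeConjecture h 3 d δ⟩

end Summit.HodgeConjecture.HodgeConjecture.Ring2.Hypotheses

end
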